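import Summits.NavierStokesRegularity.NavierStokesRegularity.Theorems.TerminalTraceTypeITraceScarL3DepthDerivativeBounds
import Literature.Analysis.FluidPDE.TaoMainEstimateAnnulus
import Literature.Analysis.FluidPDE.LocalTypeI
import HarnessLib

/-!
# Tao's Gaussian lower bound (5.7) AT DEPTH for the extinct Type-I apex class, with UNIFORM constants
# (item `TerminalTrace.TypeITraceScarL3`, stmt-NavierStokesRegularity-18385; step (Q2) of the Carleman half
# `stub_quietShell_noConcentration` of line `annulus-dichotomy`, skeleton v4 — nsreg-p2 g28 ROAD C)

Seat ns-typeII-p3 g10 (cell ns-regularity-ideate), `--supports stmt-NavierStokesRegularity-18385` (helper).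
Tao, arXiv:1908.04958 p. 38, (5.7): once the vorticity CONCENTRATES at the centre on an epoch at depth `T₁`
(Q1 of ROUND-26: `∫_{B(0,√T₁)} |ω(t)|² ≥ κ₀ T₁^{-1/2}` for `t ∈ [t₁ − c₂T₁, t₁]`, `t₁ ≤ −T₁/2`), the second
Carleman inequality propagates a Gaussian lower bound to every annulus `B(0,2R)∖B̄(0,R/2)`, `R ≥ √T₁`:
`∫_{t₁−θT₁/4}^{t₁} ∫_{B(0,2R)∖B̄(0,R/2)} |ω|² ≥ (θT₁/4)·κ₀T₁^{-1/2}·exp(−E R²/(θT₁))`.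
The tree proves (5.7) for CLASSICAL solutions under the normalised sup bounds (5.4)/(5.5)
(`vorticity_gaussian_lower_bound_annulus_integral`, TaoMainEstimateAnnulus :187).  For the apex class those
sup bounds hold AT DEPTH with constants depending on the class only (`exists_depth_gradient_vorticity_le`:
rate `C/√(−t)` + Seregin–Šverák uniform regularity), so:

* `exists_depth_gaussian_lower_bound` — for every `(C, D₀, κ₀, c₂)` there are `θ ∈ (0, min(½, c₂)]` and
  `E > 0` such that for EVERY apex pair `(U, P)` (suitable in every `Q(a)`, `D ≤ D₀` at apices `≤ 0`,
  a.e. rate `C/√(−s)`), every continuous smooth-sliced representative `v` with the pointwise rate which is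
  classical on every `[b − T, b]`, `b < 0` (the typer's `exists_classical_repr_of_apexPackage`), every
  scale `T₁ > 0`, every `t₁ ≤ −T₁/2` carrying the Q1-concentration on `[t₁ − c₂T₁, t₁]`, and every
  `R ≥ √T₁`: the displayed Gaussian lower bound.  `θ, E` are UNIFORM — this is what lets the shell ratio
  `A₀` of the cut depend on the class only.

WHAT THIS IS NOT: not Q1, not Stub Q234, not NS regularity — Tao's (5.7) instantiated in the apex class.
[cite: Tao2021QuantitativeNS, Thm. 5.1 proof p. 38 (5.7)]
-/

noncomputable section

set_option linter.dupNamespace false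

namespace Summit.NavierStokesRegularity.NavierStokesRegularity.Theorems.TypeITraceScarL3

open MeasureTheory Set Function Filter Topology Metric
open Literature.Analysis.FluidPDE
open scoped NNReal ENNReal InnerProductSpace RealInnerProductSpace

/-- **Tao's (5.7) at depth, uniform in the apex class.**  See the module docstring.
[cite: Tao2021QuantitativeNS, Thm. 5.1 proof p. 38 (5.7)] -/
theorem exists_depth_gaussian_lower_bound (C : ℝ) (D₀ : ℝ≥0) {κ₀ c₂ : ℝ} (hκ₀ : 0 < κ₀) (hc₂ : 0 < c₂) :
    ∃ θ E : ℝ, 0 < θ ∧ θ ≤ c₂ ∧ θ ≤ 1 / 2 ∧ 0 < E ∧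
    ∀ (U : ℝ → EuclideanSpace ℝ (Fin 3) → EuclideanSpace ℝ (Fin 3))
      (P : ℝ → EuclideanSpace ℝ (Fin 3) → ℝ),
      (∀ a : ℝ, 0 < a →
        IsSuitableWeakSolutionInBall a (0 : ℝ × EuclideanSpace ℝ (Fin 3)) U P) →
      (∀ z₀ : ℝ × EuclideanSpace ℝ (Fin 3), z₀.1 ≤ 0 →
        ∀ r : ℝ, 0 < r → cknD r z₀ P ≤ D₀) →
      (∀ s : ℝ, s < 0 →
        ∀ᵐ y : EuclideanSpace ℝ (Fin 3), ‖U s y‖ ≤ C / Real.sqrt (-s)) →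
      ∀ v : ℝ → EuclideanSpace ℝ (Fin 3) → EuclideanSpace ℝ (Fin 3),
        (∀ᵐ w ∂(volume.restrict (Iio (0 : ℝ) ×ˢ (univ : Set (EuclideanSpace ℝ (Fin 3))))),
          uncurry U w = uncurry v w) →
        ContinuousOn (uncurry v) (Iio (0 : ℝ) ×ˢ (univ : Set (EuclideanSpace ℝ (Fin 3)))) →
        (∀ t < 0, ContDiff ℝ (⊤ : ℕ∞) (v t)) →
        (∀ t < 0, ∀ x : EuclideanSpace ℝ (Fin 3), ‖v t x‖ ≤ C / Real.sqrt (-t)) →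
        (∀ b T : ℝ, b < 0 → 0 < T →
          ∃ q : ℝ → EuclideanSpace ℝ (Fin 3) → ℝ, IsClassicalNSSolutionOn (Icc (b - T) b) 1 0 v q) →
        ∀ T₁ : ℝ, 0 < T₁ → ∀ t₁ : ℝ, t₁ ≤ -T₁ / 2 →
          (∀ t ∈ Icc (t₁ - c₂ * T₁) t₁,
            κ₀ * T₁ ^ (-(1 / 2 : ℝ)) ≤
              ∫ x in ball (0 : EuclideanSpace ℝ (Fin 3)) (Real.sqrt T₁), ‖curl (v t) x‖ ^ 2) →
          ∀ R : ℝ, Real.sqrt T₁ ≤ R →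
            θ * T₁ / 4 * (κ₀ * T₁ ^ (-(1 / 2 : ℝ)) * Real.exp (-(E * R ^ 2 / (θ * T₁)))) ≤
              ∫ t in (t₁ - θ * T₁ / 4)..t₁,
                ∫ x in ball (0 : EuclideanSpace ℝ (Fin 3)) (2 * R) \ closedBall 0 (R / 2),
                  ‖vorticity v t x‖ ^ 2 := by
  -- ### the uniform constants
  obtain ⟨K₁, K₂, hK₁, hK₂, hgrad⟩ := exists_depth_gradient_vorticity_le C D₀
  obtain ⟨K₀, hK₀, hG⟩ := vorticity_gaussian_lower_bound_annulus_integral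
  have hK₀pos : 0 < K₀ := by linarith
  set θ : ℝ := min (1 / 2) (min c₂ (min (1 / (2 * (C ^ 2 + 1))) (1 / (2 * K₁ + 1)))) with hθ
  have hθpos : 0 < θ := by
    rw [hθ]; exact lt_min (by norm_num) (lt_min hc₂ (lt_min (by positivity) (by positivity)))
  have hθhalf : θ ≤ 1 / 2 := min_le_left _ _
  have hθ1 : θ ≤ 1 := hθhalf.trans (by norm_num)
  have hθc₂ : θ ≤ c₂ := (min_le_right _ _).trans (min_le_left _ _)
  have hθC : θ ≤ 1 / (2 * (C ^ 2 + 1)) :=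
    (min_le_right _ _).trans ((min_le_right _ _).trans (min_le_left _ _))
  have hθK : θ ≤ 1 / (2 * K₁ + 1) :=
    (min_le_right _ _).trans ((min_le_right _ _).trans (min_le_right _ _))
  have hsθ : 0 < Real.sqrt θ := Real.sqrt_pos.2 hθpos
  set M' : ℝ := 8 * K₁ + 3 * K₂ + 1 with hM'
  have hM'1 : 1 ≤ M' := by rw [hM']; linarith
  have hM'pos : 0 < M' := by linarith
  set L : ℝ := 2 * K₀ * M' ^ 2 / (κ₀ * Real.sqrt θ) with hL
  have hLpos : 0 < L := by rw [hL]; positivity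
  set a : ℝ := K₀ + L with ha
  have haK₀ : K₀ ≤ a := by rw [ha]; linarith
  have hapos : 0 < a := by linarith
  set E : ℝ := 2 * K₀ * a ^ 3 with hE
  have hEpos : 0 < E := by rw [hE]; positivity
  refine ⟨θ, E, hθpos, hθc₂, hθhalf, hEpos, ?_⟩
  intro U P hsw hD hrate v hvU hvc hvs hvrate hvcl T₁ hT₁ t₁ ht₁ hconc R hR
  -- ### the Gaussian slab `[t₁ − T, t₁]`, `T = θ T₁`
  set T : ℝ := θ * T₁ with hT
  have hTpos : 0 < T := mul_pos hθpos hT₁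
  have hTle : T ≤ T₁ / 2 := by
    rw [hT]; nlinarith
  have ht₁neg : t₁ < 0 := by linarith
  obtain ⟨q, hcl⟩ := hvcl t₁ T ht₁neg hTpos
  have hsT : 0 < Real.sqrt T := Real.sqrt_pos.2 hTpos
  have hsT₁ : 0 < Real.sqrt T₁ := Real.sqrt_pos.2 hT₁
  -- times of the slab are at depth `≥ T₁/2 ≥ T`
  have hdepth : ∀ t ∈ Icc (t₁ - T) t₁, t < 0 ∧ T₁ / 2 ≤ -t ∧ T ≤ -t := by
    intro t ht
    refine ⟨by linarith [ht.2], by linarith [ht.2], by linarith [ht.2]⟩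
  -- ### (5.5'): `|v| ≤ T^{-1/2}`, `|∇v| ≤ T⁻¹` on the slab
  have h55 : ∀ t ∈ Icc (t₁ - T) t₁, ∀ x : EuclideanSpace ℝ (Fin 3),
      ‖v t x‖ ≤ (Real.sqrt T)⁻¹ ∧ ‖fderiv ℝ (v t) x‖ ≤ T⁻¹ := by
    intro t ht x
    obtain ⟨htneg, hhalf, hTt⟩ := hdepth t ht
    have hmt : 0 < -t := by linarith
    have hst : 0 < Real.sqrt (-t) := Real.sqrt_pos.2 hmt
    obtain ⟨hg1, -, -⟩ := hgrad U P hsw hD hrate v hvU hvc hvs t htneg x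
    constructor
    · -- `C/√(−t) ≤ |C|/√(−t) ≤ 1/√T` since `C² T ≤ −t`
      have hC2T : C ^ 2 * T ≤ -t := by
        have h1 : C ^ 2 * θ ≤ 1 / 2 := by
          have hC2 : 0 ≤ C ^ 2 := sq_nonneg C
          calc C ^ 2 * θ ≤ C ^ 2 * (1 / (2 * (C ^ 2 + 1))) := mul_le_mul_of_nonneg_left hθC hC2
            _ = (C ^ 2 / (C ^ 2 + 1)) / 2 := by field_simp
            _ ≤ 1 / 2 := by
                have : C ^ 2 / (C ^ 2 + 1) ≤ 1 := by
                  rw [div_le_one (by positivity)]; linarith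
                linarith
        calc C ^ 2 * T = C ^ 2 * θ * T₁ := by rw [hT]; ring
          _ ≤ 1 / 2 * T₁ := mul_le_mul_of_nonneg_right h1 hT₁.le
          _ ≤ -t := by linarith
      have habs : |C| * Real.sqrt T ≤ Real.sqrt (-t) := by
        rw [Real.le_sqrt (by positivity) hmt.le, mul_pow, sq_abs, Real.sq_sqrt hTpos.le]
        exact hC2T
      calc ‖v t x‖ ≤ C / Real.sqrt (-t) := hvrate t htneg x
        _ ≤ |C| / Real.sqrt (-t) := div_le_div_of_nonneg_right (le_abs_self C) hst.le
        _ ≤ (Real.sqrt T)⁻¹ := by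
            rw [div_le_iff₀ hst, inv_mul_eq_div, le_div_iff₀ hsT]
            exact habs
    · -- `K₁/(−t) ≤ 2K₁/T₁ ≤ 1/(θT₁) = T⁻¹`
      have h2 : 2 * K₁ * θ ≤ 1 := by
        calc 2 * K₁ * θ ≤ 2 * K₁ * (1 / (2 * K₁ + 1)) := mul_le_mul_of_nonneg_left hθK (by positivity)
          _ = 2 * K₁ / (2 * K₁ + 1) := by ring
          _ ≤ 1 := by rw [div_le_one (by positivity)]; linarith
      calc ‖fderiv ℝ (v t) x‖ ≤ K₁ / (-t) := hg1
        _ ≤ K₁ / (T₁ / 2) := div_le_div_of_nonneg_left hK₁ (by positivity) hhalf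
        _ = 2 * K₁ * θ / T := by rw [hT]; field_simp
        _ ≤ 1 / T := div_le_div_of_nonneg_right h2 hTpos.le
        _ = T⁻¹ := one_div T
  -- ### (5.4): `|ω| ≤ M'/T`, `|∇ω| ≤ M'/(T√T)` on the slab
  have h54 : ∀ t ∈ Icc (t₁ - T) t₁, ∀ x : EuclideanSpace ℝ (Fin 3),
      ‖vorticity v t x‖ ≤ M' / T ∧ ‖fderiv ℝ (vorticity v t) x‖ ≤ M' / (T * Real.sqrt T) := by
    intro t ht x
    obtain ⟨htneg, hhalf, hTt⟩ := hdepth t ht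
    have hmt : 0 < -t := by linarith
    have hst : 0 < Real.sqrt (-t) := Real.sqrt_pos.2 hmt
    obtain ⟨-, hg2, hg3⟩ := hgrad U P hsw hD hrate v hvU hvc hvs t htneg x
    constructor
    · calc ‖vorticity v t x‖ ≤ 4 * K₁ / (-t) := hg2
        _ ≤ 4 * K₁ / (T₁ / 2) := div_le_div_of_nonneg_left (by positivity) (by positivity) hhalf
        _ = 8 * K₁ * θ / T := by rw [hT]; field_simp; ring
        _ ≤ M' / T := by
            refine div_le_div_of_nonneg_right ?_ hTpos.le
            calc 8 * K₁ * θ ≤ 8 * K₁ * 1 := mul_le_mul_of_nonneg_left hθ1 (by positivity)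
              _ ≤ M' := by rw [hM']; linarith
    · have hmono : T * Real.sqrt T ≤ (-t) * Real.sqrt (-t) :=
        mul_le_mul hTt (Real.sqrt_le_sqrt hTt) hsT.le hmt.le
      calc ‖fderiv ℝ (vorticity v t) x‖ ≤ K₂ / ((-t) * Real.sqrt (-t)) := hg3
        _ ≤ K₂ / (T * Real.sqrt T) := div_le_div_of_nonneg_left hK₂ (by positivity) hmono
        _ ≤ M' / (T * Real.sqrt T) := by
            refine div_le_div_of_nonneg_right ?_ (by positivity)
            rw [hM']; linarith
  -- ### (5.6): the concentration on the slab (`T ≤ c₂ T₁`)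
  have h56 : ∀ t ∈ Icc (t₁ - T) t₁, κ₀ * T₁ ^ (-(1 / 2 : ℝ)) ≤
      ∫ x in ball (0 : EuclideanSpace ℝ (Fin 3)) (Real.sqrt T₁), ‖vorticity v t x‖ ^ 2 := by
    intro t ht
    have hTc : T ≤ c₂ * T₁ := by rw [hT]; exact mul_le_mul_of_nonneg_right hθc₂ hT₁.le
    exact hconc t ⟨by linarith [ht.1], ht.2⟩
  -- ### the smallness `2K₀M'²e^{−a} ≤ δ√T = κ₀√θ`
  have hδpos : 0 < κ₀ * T₁ ^ (-(1 / 2 : ℝ)) := mul_pos hκ₀ (Real.rpow_pos_of_pos hT₁ _)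
  have hδT : κ₀ * T₁ ^ (-(1 / 2 : ℝ)) * Real.sqrt T = κ₀ * Real.sqrt θ := by
    rw [hT, Real.rpow_neg hT₁.le, ← Real.sqrt_eq_rpow, Real.sqrt_mul hθpos.le]
    field_simp
  have hsmall : 2 * K₀ * M' ^ 2 * Real.exp (-a) ≤ κ₀ * T₁ ^ (-(1 / 2 : ℝ)) * Real.sqrt T := by
    rw [hδT]
    have h1 : Real.exp (-a) ≤ 1 / L := by
      rw [Real.exp_neg]
      have h2 : L ≤ Real.exp a := by
        calc L ≤ a + 1 := by rw [ha]; linarith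
          _ ≤ Real.exp a := Real.add_one_le_exp a
      rw [inv_eq_one_div]
      exact one_div_le_one_div_of_le hLpos h2
    calc 2 * K₀ * M' ^ 2 * Real.exp (-a) ≤ 2 * K₀ * M' ^ 2 * (1 / L) :=
          mul_le_mul_of_nonneg_left h1 (by positivity)
      _ = κ₀ * Real.sqrt θ := by rw [hL]; field_simp
  -- ### apply (5.7)
  have hRρ : Real.sqrt T₁ ≤ R := hR
  have hTR : T ≤ R ^ 2 := by
    have h1 : T₁ ≤ R ^ 2 := by
      calc T₁ = Real.sqrt T₁ ^ 2 := (Real.sq_sqrt hT₁.le).symm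
        _ ≤ R ^ 2 := pow_le_pow_left₀ hsT₁.le hR 2
    linarith
  have hmain := hG hcl hTpos haK₀ hM'1 hδpos hsT₁ hRρ hTR h55 h54 h56 hsmall
  -- rewrite `T = θ T₁` and `E = 2 K₀ a³`
  have hexp : Real.exp (-(2 * K₀ * a ^ 3 * R ^ 2 / T)) = Real.exp (-(E * R ^ 2 / (θ * T₁))) := by
    rw [hE, hT]
  rw [hexp] at hmain
  have hT4 : T / 4 = θ * T₁ / 4 := by rw [hT]
  rw [hT4] at hmain
  have hwin : t₁ - T / 4 = t₁ - θ * T₁ / 4 := by rw [hT]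
  rw [hwin] at hmain
  exact hmain

end Summit.NavierStokesRegularity.NavierStokesRegularity.Theorems.TypeITraceScarL3

end
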